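import Summits.QuantumFields.YangMills.Theorems.UnitScaleTiltProp7FlatBlockConstLaplace
import Summits.QuantumFields.YangMills.Theorems.UnitScaleTiltProp7FlatProjectorSeam
import Summits.QuantumFields.YangMills.Theorems.UnitScaleTiltProp7HessOnPrintSlice
import HarnessLib

/-!
# Route `UnitScaleTilt`, crux K1 «MinimiserStabilityRegPr» (stmt-QuantumFields-19200), route-R E′ architecture (A′) «HCOW-VIA-Σ», package P-A4 — FILE S2:
# THE DISPLAYED N06 ROW `bern_P` («`∀ f, R_S(W) f = 0 → ‖D_W f‖² ≤ C_P·‖f‖²`», ★★OWNER RULING g28-№15) AT THE FLAT MEMBER `W = 1`, BY KERNEL, FOR EVERY `K`: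
# `R_S(1) f = 0 ⟹ ‖D_1 f‖² ≤ (6·243³∕256)·‖f‖²` — condition (c3) of the ruling, an ABSOLUTE constant (no `K`, no volume, no `L`)

Cell `ym3-torus`, width seat `ym3-torus-px12` (gen 5), P-A4 pen of record (★p1 g17 WORD 15).  WHY IT HOLDS (LOCATE «(P-A4)-FLAT» 05c086f2, route S): `R_S(U₀)` is the orthogonal
projection onto `Δ^η_{U₀} N_S(U₀)`, `N_S = ker(Q∘D)` (✓ `RS_eq_projR`), so `R_S f = 0` says `Δ^η f ⊥ N_S` (§1, any background).  At `U₀ = 1` every gauge parameter whose `(K−n)`-block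
sums vanish lies in `N_S` (flat (3.115): `Q_{K−n}(∂λ) = ∂(siteAvg λ) = 0`, lit ✓ `bondAvgIter_grad`, (J2) ✓ `Qk_one_toL2`) (§2); hence `Δ^η f` is orthogonal to all of them, i.e. BLOCK-CONSTANT
(§3), i.e. the flat lattice Laplacian of every real component of `f` is constant on every `(K−n)`-block (§4); FILE S1 ✓ `Prop7FlatBlockConstLaplace.grad_sq_le_of_blockConst_T3_all`
then gives `ℓ²Σ|∇·|² ≤ C·Σ|·|²` per component, and the member's norms (`‖D_1 f‖² = c₀η⁻²Σ_b|f(b₊) − f(b₋)|²`, `‖f‖² = c₀Σ_x|f(x)|²`, `η⁻¹ = ℓ`) assemble the row (§5).  The curved row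
`bern_P(W)` ([Balaban1985BackgroundPropagators] (3.42)∕(3.133) class) is DISPLAYED under the ruling; this file is its A6 certificate at the flat member, nothing more.
THEOREMS ONLY (0 `def`, 0 `sorry`); `--supports stmt-QuantumFields-19200`, count-neutral.  YM₃ on T³ is a ladder rung (R3), not the Clay problem; nothing here claims `bern_P` at a
curved background, hcoW, (A′), E′, a stub, the crux, d = 4 or the mass gap.

WHAT IS PROVED (ns `…Theorems.Prop7BernPFlatMember`).
* §1 (any `U₀`) ★ `inner_covLapSite_eq_zero_of_RS_eq_zero` — `R_S(U₀) f = 0`, `l ∈ N_S(U₀)` ⟹ `⟪l, Δ^η_{U₀} f⟫ = 0`.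
* §2 (flat) `DL2_one_toL2S` (`D_1(toL2S λ) = toL2 (η⁻¹•∂λ)`), ★ `toL2S_mem_NS_one_of_blockSum_eq_zero`.
* §3 ★★ `covLapSite_one_blockConst_of_RS_eq_zero` — `R_S(1) f = 0` ⟹ `toL2S⁻¹(Δ^η_1 f)` takes the same value at any two points of a `(K−n)`-block.
* §4 `covLapSite_one_toL2S_apply` (`toL2S⁻¹(Δ^η_1(toL2S F))(x) = η⁻²•(laplace 1 F)(x)`), ★★ `laplace_blockConst_of_RS_eq_zero` (entries∕`re`∕`im` via px4's ✓ `Prop7FlatProjectorSeam.laplace_entry_re∕_im`).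
* §5 ★★★ `bernP_flat_member` — `∀ f, RS F n K h c₀ cB 1 f = 0 → ‖DL2 F n K c₀ 1 f‖² ≤ (6·243³∕256)·‖f‖²`; ★★★ `div_sq_le_flat_of_isLandauPrintS_one` — through the door ✓p687224:
  `IsLandauPrintS F n K h c₀ cB 1 X ⟹ ‖D*_1 X̃‖² ≤ (6·243³∕256)·‖X̃‖²` (the crude slice `DIV ≤ δ₁ℓ⁻²M` at the flat member, `ζ = 0`, `δ₁` absolute).
HONEST SCOPE.  Flat member only; linear algebra + FILE S1; crude absolute constant (≈ 3.4·10⁵); the curved `bern_P` is an N06-class displayed row, not proved here.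

References: T. Bałaban, CMP 99 (1985) 389–434 [Balaban1985BackgroundPropagators] ((3.3) p.391, (3.8) p.392, (3.21)–(3.23) p.394, (3.42) p.398, (3.115) p.418, (3.133) p.422);
CMP 95 (1984) 17–40 [Balaban1984PropagatorsI] ((1.18) p.20, (1.21) p.21, Sect. C p.22); CMP 99 (1985) 75–102 [Balaban1985RegularSpaces] ((1.38) p.82); CMP 102 (1985) 277–309
[Balaban1985Variational] ((21) p.281, Prop. 7 p.299).
-/

set_option autoImplicit false

noncomputable section

open scoped InnerProductSpace ComplexConjugate ComplexOrder Matrix.Norms.L2Operator BigOperators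

namespace Summit.QuantumFields.YangMills.Theorems.Prop7BernPFlatMember

open Literature.MathematicalPhysics.QuantumFieldTheory.Balaban1983to89
open Literature.MathematicalPhysics.QuantumFieldTheory.Balaban1983to89.T3ContinuumYM3Torus
open T3SectALandauChart (eta eta_pos)
open LatticeFieldCalculus (grad pdiff laplace bondAvgIter siteAvgIter)
open Finset
open B9SectCLatticeCarrier (Bond)
open B9Eq311L2Pairing (WL2)
open B11Eq103H1Complex (SiteL2K BondL2K projR)
open B5Eq118OneStroke (iterBlock mem_iterBlock siteAvgIter_eq_blockSum)
open Summit.QuantumFields.YangMills.Theorems.Prop7SectET3Transport (periodsT3 siteEquiv bondEquiv bgOfCfg)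
open Summit.QuantumFields.YangMills.Theorems.Prop7SectET3HilbertLetters (W₂ frobEquiv toL2 toL2S toL2B QL2 DL2 DstarL2 covLapSite inner_toL2 adjoint_DL2 QL2_toL2 DL2_apply)
open Summit.QuantumFields.YangMills.Theorems.Prop7SectET3GaugeProjector (QDS NS RS RS_eq_projR QDS_apply)
open Summit.QuantumFields.YangMills.Theorems.Prop7SectET3CurvedPropagators (Qk)
open Summit.QuantumFields.YangMills.Theorems.Prop7SectET3RealCoordSums (inner_toL2S)
open Summit.QuantumFields.YangMills.Theorems.Prop7LaplaceAFlatLetters (sum_entries_re_im norm_sq_toL2 norm_sq_toL2S bgOfCfg_one Qk_one_toL2)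
open Summit.QuantumFields.YangMills.Theorems.Prop7SPrint (IsLandauPrintS)
open Summit.QuantumFields.YangMills.Theorems.Prop7HessOnPrintSlice (div_sq_le_of_bernstein_ker_RS_of_isLandauPrintS)
open Summit.QuantumFields.YangMills.Theorems.Prop7FlatBlockConstLaplace (grad_sq_le_of_blockConst_T3_all)

variable (F : T3Family) (n K : ℕ) (h : n ≤ K) (c₀ cB : ℝ) [Fact (0 < c₀)] [Fact (0 < cB)]

/-! ## §1 Any background: `R_S f = 0` means `Δ^η f ⊥ N_S` -/

omit [Fact (0 < cB)] in
/-- ★ **`R_S(U₀) f = 0` ⟹ `⟪λ, Δ^η_{U₀} f⟫ = 0` FOR EVERY `λ ∈ N_S(U₀)`** — `R_S` is the orthogonal projection onto `(N_S).map Δ^η` (✓ `RS_eq_projR`), zero iff orthogonal, and `Δ^η = D†D` is symmetric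
(✓ `adjoint_DL2`). [cite: Balaban1985BackgroundPropagators, (3.21)–(3.23) p.394] -/
theorem inner_covLapSite_eq_zero_of_RS_eq_zero (U₀ : GaugeField (F.P K) 0 (Matrix.specialUnitaryGroup (Fin 2) ℂ))
    {f : SiteL2K ℂ 3 (periodsT3 F K) c₀ W₂} (hf : RS F n K h c₀ cB U₀ f = 0)
    {l : SiteL2K ℂ 3 (periodsT3 F K) c₀ W₂} (hl : l ∈ NS F n K h c₀ cB U₀) :
    ⟪l, covLapSite F n K c₀ U₀ f⟫_ℂ = 0 := by
  rw [RS_eq_projR] at hf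
  haveI : CompleteSpace ↥((LinearMap.ker (QDS F n K h c₀ cB U₀)).map (covLapSite F n K c₀ U₀)) := FiniteDimensional.complete ℂ _
  change ((LinearMap.ker (QDS F n K h c₀ cB U₀)).map (covLapSite F n K c₀ U₀)).starProjection f = 0 at hf
  rw [Submodule.starProjection_apply_eq_zero_iff, Submodule.mem_orthogonal] at hf
  have h1 : ⟪covLapSite F n K c₀ U₀ l, f⟫_ℂ = 0 := hf _ (Submodule.mem_map_of_mem hl)
  have hsymm : ⟪covLapSite F n K c₀ U₀ l, f⟫_ℂ = ⟪l, covLapSite F n K c₀ U₀ f⟫_ℂ := by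
    simp only [covLapSite, LinearMap.comp_apply]
    rw [← adjoint_DL2, LinearMap.adjoint_inner_left, LinearMap.adjoint_inner_right]
  rw [← hsymm]
  exact h1

/-! ## §2 The flat member: `D_1` on functions, and block-sum-zero parameters are in `N_S(1)` -/

variable {F n K c₀}

/-- **`D_1` ON THE ROUTE'S FUNCTIONS**: `D_1(toL2S λ) = toL2 (b ↦ η⁻¹•(λ(b₊) − λ(b₋)))`. [cite: Balaban1985BackgroundPropagators, (3.3) p.391] -/
theorem DL2_one_toL2S (l : Site (F.P K) 0 → Matrix (Fin 2) (Fin 2) ℂ) :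
    DL2 F n K c₀ (1 : GaugeField (F.P K) 0 (Matrix.specialUnitaryGroup (Fin 2) ℂ)) (toL2S F K c₀ l)
      = toL2 F K c₀ (fun b : PBond (F.P K) 0 => (((eta F n K : ℝ) : ℂ)⁻¹) • (l b.tgt - l b.src)) := by
  apply (toL2 F K c₀).symm.injective
  rw [LinearEquiv.symm_apply_apply]
  funext b
  rw [DL2_apply, bgOfCfg_one, inv_one, Units.val_one, mul_one,
    show (((1 : GaugeField (F.P K) 0 (Matrix.specialUnitaryGroup (Fin 2) ℂ)) b : Matrix.specialUnitaryGroup (Fin 2) ℂ) : Matrix (Fin 2) (Fin 2) ℂ) = 1 from rfl,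
    one_mul]

/-- the same read entrywise through `grad`: the function is `grad η⁻¹ λ` (real scalar acting on the ℂ-module of matrices). [cite: Balaban1984PropagatorsI, (1.2) p.18] -/
theorem smul_sub_eq_grad (l : Site (F.P K) 0 → Matrix (Fin 2) (Fin 2) ℂ) (b : PBond (F.P K) 0) :
    (((eta F n K : ℝ) : ℂ)⁻¹) • (l b.tgt - l b.src) = grad ((eta F n K)⁻¹) l b := by
  rw [grad, ← Complex.ofReal_inv, Complex.coe_smul]

/-- ★ **BLOCK-SUM-ZERO GAUGE PARAMETERS ARE RESIDUAL AT THE FLAT MEMBER**: if `Σ_{x∈B^{K−n}(y)} λ(x) = 0` for every block, then `toL2S λ ∈ N_S(1) = ker(Q(1)∘D_1)` — flat (3.115)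
`Q_{K−n}(∂λ) = ∂(siteAvg_{K−n} λ) = ∂0 = 0`. [cite: Balaban1985BackgroundPropagators, (3.115) p.418, (3.21) p.394; Balaban1984PropagatorsI, (1.18) p.20] -/
theorem toL2S_mem_NS_one_of_blockSum_eq_zero (l : Site (F.P K) 0 → Matrix (Fin 2) (Fin 2) ℂ)
    (hl : ∀ y : Site (F.P K) (K - n), ∑ x ∈ iterBlock (K - n) y, l x = 0) :
    toL2S F K c₀ l ∈ NS F n K h c₀ cB (1 : GaugeField (F.P K) 0 (Matrix.specialUnitaryGroup (Fin 2) ℂ)) := by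
  have hk : K - n ≤ (F.P K).m + (F.P K).K := by
    have := F.hm
    show K - n ≤ F.m + K
    omega
  rw [NS, LinearMap.mem_ker, QDS_apply, DL2_one_toL2S]
  have hfun : (fun b : PBond (F.P K) 0 => (((eta F n K : ℝ) : ℂ)⁻¹) • (l b.tgt - l b.src)) = grad ((eta F n K)⁻¹) l :=
    funext fun b => smul_sub_eq_grad l b
  rw [hfun]
  -- `QL2 1 (toL2 A) = toL2B (QTwS 1 A)`, and `η • QL2 = Qk`; use ✓`Qk_one_toL2` after inserting `η`
  have hη : ((eta F n K : ℝ) : ℂ) ≠ 0 := by exact_mod_cast (eta_pos F n K).ne'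
  have hQk : Qk F n K h c₀ cB (1 : GaugeField (F.P K) 0 (Matrix.specialUnitaryGroup (Fin 2) ℂ)) (toL2 F K c₀ (grad ((eta F n K)⁻¹) l)) = 0 := by
    rw [Qk_one_toL2]
    have hsite : siteAvgIter (K - n) l = 0 := by
      funext y
      rw [siteAvgIter_eq_blockSum (K - n) hk l y, hl y, smul_zero]
      rfl
    have hzero : (fun c : PBond (F.P n) 0 => bondAvgIter (K - n) (grad ((eta F n K)⁻¹) l) (T3LevelShift.bondShift (T3PrintedRegularOrbits.sites_eq F n K h) c))
        = 0 := by
      funext c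
      rw [B5Eq120IterProof.bondAvgIter_grad (K - n) hk, hsite]
      simp [grad]
    rw [hzero, map_zero]
  have hQk' : (((eta F n K : ℝ) : ℂ)) • QL2 F n K h c₀ cB (1 : GaugeField (F.P K) 0 (Matrix.specialUnitaryGroup (Fin 2) ℂ)) (toL2 F K c₀ (grad ((eta F n K)⁻¹) l)) = 0 := by
    have := hQk
    rw [Qk, LinearMap.smul_apply] at this
    exact this
  exact (smul_eq_zero.mp hQk').resolve_left hη

/-! ## §3 `R_S(1) f = 0` ⟹ `Δ^η_1 f` is block-constant -/

/-- ★★ **THE FLAT SLICE CONDITION MAKES THE LAPLACIAN BLOCK-CONSTANT**: if `R_S(1) f = 0` then `G := toL2S⁻¹(Δ^η_1 f)` takes the same value at any two sites of one `(K−n)`-block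
(test §1 with the residual parameter `(G(x) − G(x′))·(δ_x − δ_{x′})` of §2; `⟪toL2S λ, toL2S G⟫ = c₀Σ tr(λᴴG)` reads `tr(DᴴD) = 0`, `D = G(x) − G(x′)`).
[cite: Balaban1985BackgroundPropagators, (3.21)–(3.23) p.394, (3.115) p.418] -/
theorem covLapSite_one_blockConst_of_RS_eq_zero {f : SiteL2K ℂ 3 (periodsT3 F K) c₀ W₂}
    (hf : RS F n K h c₀ cB (1 : GaugeField (F.P K) 0 (Matrix.specialUnitaryGroup (Fin 2) ℂ)) f = 0)
    (y : Site (F.P K) (K - n)) {x x' : Site (F.P K) 0} (hx : x ∈ iterBlock (K - n) y) (hx' : x' ∈ iterBlock (K - n) y) :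
    (toL2S F K c₀).symm (covLapSite F n K c₀ 1 f) x = (toL2S F K c₀).symm (covLapSite F n K c₀ 1 f) x' := by
  classical
  by_cases hxx : x = x'
  · rw [hxx]
  set G : Site (F.P K) 0 → Matrix (Fin 2) (Fin 2) ℂ := (toL2S F K c₀).symm (covLapSite F n K c₀ 1 f) with hG
  set D : Matrix (Fin 2) (Fin 2) ℂ := G x - G x' with hD
  -- the test parameter
  set l : Site (F.P K) 0 → Matrix (Fin 2) (Fin 2) ℂ := fun z => if z = x then D else if z = x' then -D else 0 with hl
  have hblock : ∀ y' : Site (F.P K) (K - n), ∑ z ∈ iterBlock (K - n) y', l z = 0 := by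
    intro y'
    rw [mem_iterBlock] at hx hx'
    by_cases hy : y' = y
    · subst hy
      have hxm : x ∈ iterBlock (K - n) y' := by rw [mem_iterBlock]; exact hx
      have hxm' : x' ∈ iterBlock (K - n) y' := by rw [mem_iterBlock]; exact hx'
      rw [← Finset.add_sum_erase _ _ hxm, ← Finset.add_sum_erase _ _ (Finset.mem_erase.mpr ⟨Ne.symm hxx, hxm'⟩)]
      have hrest : ∑ z ∈ ((iterBlock (K - n) y').erase x).erase x', l z = 0 :=
        Finset.sum_eq_zero fun z hz => by
          have h1 : z ≠ x' := Finset.ne_of_mem_erase hz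
          have h2 : z ≠ x := Finset.ne_of_mem_erase (Finset.mem_of_mem_erase hz)
          simp only [hl, if_neg h2, if_neg h1]
      rw [hrest, add_zero]
      simp only [hl, if_pos rfl, if_neg (Ne.symm hxx)]
      exact add_neg_cancel D
    · refine Finset.sum_eq_zero fun z hz => ?_
      rw [mem_iterBlock] at hz
      have h2 : z ≠ x := fun e => hy (by rw [← hz, e, hx])
      have h1 : z ≠ x' := fun e => hy (by rw [← hz, e, hx'])
      simp only [hl, if_neg h2, if_neg h1]
  have hmem := toL2S_mem_NS_one_of_blockSum_eq_zero (h := h) (c₀ := c₀) (cB := cB) l hblock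
  have horth := inner_covLapSite_eq_zero_of_RS_eq_zero F n K h c₀ cB 1 hf hmem
  -- read the pairing on functions
  have hGf : covLapSite F n K c₀ 1 f = toL2S F K c₀ G := by rw [hG, LinearEquiv.apply_symm_apply]
  rw [hGf, inner_toL2S] at horth
  have hc₀ : ((c₀ : ℝ) : ℂ) ≠ 0 := by exact_mod_cast (Fact.out : 0 < c₀).ne'
  have hsum : ∑ z : Site (F.P K) 0, Matrix.trace ((l z).conjTranspose * G z) = Matrix.trace (D.conjTranspose * D) := by
    rw [← Finset.add_sum_erase _ _ (Finset.mem_univ x), ← Finset.add_sum_erase _ _ (Finset.mem_erase.mpr ⟨Ne.symm hxx, Finset.mem_univ x'⟩)]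
    have hrest : ∑ z ∈ ((Finset.univ : Finset (Site (F.P K) 0)).erase x).erase x', Matrix.trace ((l z).conjTranspose * G z) = 0 :=
      Finset.sum_eq_zero fun z hz => by
        have h1 : z ≠ x' := Finset.ne_of_mem_erase hz
        have h2 : z ≠ x := Finset.ne_of_mem_erase (Finset.mem_of_mem_erase hz)
        simp only [hl, if_neg h2, if_neg h1, Matrix.conjTranspose_zero, Matrix.zero_mul, Matrix.trace_zero]
    rw [hrest, add_zero]
    have hlx : l x = D := by simp only [hl, if_pos rfl]
    have hlx' : l x' = -D := by simp only [hl, if_neg (Ne.symm hxx), if_true]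
    rw [hlx, hlx', Matrix.conjTranspose_neg, Matrix.neg_mul, Matrix.trace_neg, hD, Matrix.mul_sub, Matrix.trace_sub]
    ring
  rw [hsum, mul_eq_zero] at horth
  have htr : Matrix.trace (D.conjTranspose * D) = 0 := horth.resolve_left hc₀
  have hD0 : D = 0 := Matrix.trace_conjTranspose_mul_self_eq_zero_iff.mp htr
  exact sub_eq_zero.mp hD0


/-! ## §4 `Δ^η_1` on functions is `η⁻²·laplace 1`; entries and real parts commute with the flat letters -/

omit [Fact (0 < c₀)] in
/-- `(x − e_μ) + e_μ = x` on the route's torus. [folklore] -/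
theorem shift_unshift' (x : Site (F.P K) 0) (μ : Fin (F.P K).d) : (x.unshift μ).shift μ = x :=
  (LatticeFieldCalculus.shiftEquiv (P := F.P K) (j := 0) μ).apply_symm_apply x

/-- **`Δ^η_1` READ ON THE ROUTE'S FUNCTIONS IS `η⁻²·laplace 1`**: `toL2S⁻¹(Δ^η_1(toL2S F))(x) = η⁻²•Σ_μ(2F(x) − F(x+e_μ) − F(x−e_μ))`.
[cite: Balaban1985BackgroundPropagators, (3.23) p.394; Balaban1984PropagatorsI, (1.21) p.21] -/
theorem covLapSite_one_toL2S_apply (Fn : Site (F.P K) 0 → Matrix (Fin 2) (Fin 2) ℂ) (x : Site (F.P K) 0) :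
    (toL2S F K c₀).symm (covLapSite F n K c₀ (1 : GaugeField (F.P K) 0 (Matrix.specialUnitaryGroup (Fin 2) ℂ)) (toL2S F K c₀ Fn)) x
      = ((((eta F n K : ℝ) : ℂ)⁻¹) ^ 2) • laplace 1 Fn x := by
  rw [covLapSite, LinearMap.comp_apply, DL2_one_toL2S, Prop7LaplaceAFlatLetters.DstarL2_one_apply]
  simp only [LatticeFieldCalculus.diverg, laplace, one_smul, PBond.tgt, shift_unshift', Finset.smul_sum, pow_two, mul_smul]
  refine Finset.sum_congr rfl fun μ _ => ?_
  rw [← smul_sub]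
  congr 2
  abel

/-- ★★ **`R_S(1) f = 0` ⟹ EVERY REAL COMPONENT OF `f` HAS A BLOCK-CONSTANT FLAT LAPLACIAN**: for `F = toL2S⁻¹ f`, each `(i,j)` and `re`∕`im`, `laplace 1` of the component is constant on every
`(K−n)`-block (§3 + `covLapSite_one_toL2S_apply`, `η⁻² ≠ 0`). [cite: Balaban1985BackgroundPropagators, (3.21)–(3.23) p.394, (3.115) p.418; Balaban1984PropagatorsI, (1.21) p.21] -/
theorem laplace_blockConst_of_RS_eq_zero {f : SiteL2K ℂ 3 (periodsT3 F K) c₀ W₂}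
    (hf : RS F n K h c₀ cB (1 : GaugeField (F.P K) 0 (Matrix.specialUnitaryGroup (Fin 2) ℂ)) f = 0)
    (y : Site (F.P K) (K - n)) {x x' : Site (F.P K) 0} (hx : x ∈ iterBlock (K - n) y) (hx' : x' ∈ iterBlock (K - n) y) :
    laplace 1 ((toL2S F K c₀).symm f) x = laplace 1 ((toL2S F K c₀).symm f) x' := by
  have hG := covLapSite_one_blockConst_of_RS_eq_zero (h := h) (cB := cB) hf y hx hx'
  have hfF : f = toL2S F K c₀ ((toL2S F K c₀).symm f) := (LinearEquiv.apply_symm_apply _ f).symm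
  rw [hfF, covLapSite_one_toL2S_apply, covLapSite_one_toL2S_apply] at hG
  have hη : ((((eta F n K : ℝ) : ℂ)⁻¹) ^ 2) ≠ 0 := pow_ne_zero _ (inv_ne_zero (by exact_mod_cast (eta_pos F n K).ne'))
  exact smul_right_injective _ hη hG

/-! ## §5 ★★★ `bern_P` at the flat member -/

omit [Fact (0 < c₀)] in
/-- the flat Dirichlet form of a matrix field, entrywise in real coordinates: `Σ_b Σ_{ij} ‖(F(b₊) − F(b₋))_{ij}‖² = Σ_{ij} Σ_νΣ_x ((∂_ν re F_{ij})² + (∂_ν im F_{ij})²)`. [folklore] -/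
theorem sum_norm_sq_diff_eq (Fn : Site (F.P K) 0 → Matrix (Fin 2) (Fin 2) ℂ) :
    ∑ b : PBond (F.P K) 0, ∑ i : Fin 2, ∑ j : Fin 2, ‖(Fn b.tgt - Fn b.src) i j‖ ^ 2
      = ∑ i : Fin 2, ∑ j : Fin 2, (∑ ν : Fin (F.P K).d, ∑ x : Site (F.P K) 0, pdiff 1 ν (fun z => (Fn z i j).re) x ^ 2
          + ∑ ν : Fin (F.P K).d, ∑ x : Site (F.P K) 0, pdiff 1 ν (fun z => (Fn z i j).im) x ^ 2) := by
  rw [Finset.sum_comm]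
  refine Finset.sum_congr rfl fun i _ => ?_
  rw [Finset.sum_comm]
  refine Finset.sum_congr rfl fun j _ => ?_
  rw [B10StarCount.sum_pbond, ← Finset.sum_add_distrib, Finset.sum_comm]
  refine Finset.sum_congr rfl fun ν _ => ?_
  rw [← Finset.sum_add_distrib]
  refine Finset.sum_congr rfl fun x _ => ?_
  simp only [PBond.tgt, pdiff, one_smul, Matrix.sub_apply, Complex.sq_norm, Complex.normSq_apply, Complex.sub_re, Complex.sub_im]
  ring

omit [Fact (0 < c₀)] in
/-- the site mass entrywise in real coordinates. [folklore] -/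
theorem sum_norm_sq_site_eq (Fn : Site (F.P K) 0 → Matrix (Fin 2) (Fin 2) ℂ) :
    ∑ x : Site (F.P K) 0, ∑ i : Fin 2, ∑ j : Fin 2, ‖Fn x i j‖ ^ 2
      = ∑ i : Fin 2, ∑ j : Fin 2, (∑ x : Site (F.P K) 0, (Fn x i j).re ^ 2 + ∑ x : Site (F.P K) 0, (Fn x i j).im ^ 2) := by
  rw [Finset.sum_comm]
  refine Finset.sum_congr rfl fun i _ => ?_
  rw [Finset.sum_comm]
  refine Finset.sum_congr rfl fun j _ => ?_
  rw [← Finset.sum_add_distrib]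
  refine Finset.sum_congr rfl fun x _ => ?_
  rw [Complex.sq_norm, Complex.normSq_apply]
  ring

/-- ★★★ **THE DISPLAYED ROW `bern_P` AT THE FLAT MEMBER, BY KERNEL, FOR EVERY `K`** (★★OWNER RULING g28-№15 (c3)): for every gauge parameter `f` in the member's weighted `L²` space,
`R_S(1) f = 0 ⟹ ‖D_1 f‖² ≤ (6·243³∕256)·‖f‖²` — ABSOLUTE constant, no `K`, `L`, volume or weight dependence (print's (3.42)∕(3.133)-class Bernstein row for the range of
`G′(Q′∘·)ᵀ`, read at `U₀ = 1` where that range is «block-constant Laplacian»). [cite: Balaban1985BackgroundPropagators, (3.42) p.398, (3.133) p.422, (3.21) p.394; Balaban1984PropagatorsI, Sect. C p.22] -/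
theorem bernP_flat_member (f : SiteL2K ℂ 3 (periodsT3 F K) c₀ W₂)
    (hf : RS F n K h c₀ cB (1 : GaugeField (F.P K) 0 (Matrix.specialUnitaryGroup (Fin 2) ℂ)) f = 0) :
    ‖DL2 F n K c₀ (1 : GaugeField (F.P K) 0 (Matrix.specialUnitaryGroup (Fin 2) ℂ)) f‖ ^ 2 ≤ (6 * 243 ^ 3 / 256) * ‖f‖ ^ 2 := by
  classical
  obtain ⟨Fn, rfl⟩ : ∃ Fn : Site (F.P K) 0 → Matrix (Fin 2) (Fin 2) ℂ, f = toL2S F K c₀ Fn := ⟨_, (LinearEquiv.apply_symm_apply _ f).symm⟩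
  -- block-constancy of the flat Laplacian of every real component
  have hblk : ∀ (y : Site (F.P K) (K - n)) (x x' : Site (F.P K) 0), x ∈ iterBlock (K - n) y → x' ∈ iterBlock (K - n) y →
      laplace 1 Fn x = laplace 1 Fn x' := fun y x x' hx hx' => by
    have := laplace_blockConst_of_RS_eq_zero (h := h) (cB := cB) hf y hx hx'
    rwa [LinearEquiv.symm_apply_apply] at this
  -- the representative value on each block
  have hcomp : ∀ u : Site (F.P K) 0 → ℝ, (∀ (y : Site (F.P K) (K - n)) (x x' : Site (F.P K) 0), x ∈ iterBlock (K - n) y → x' ∈ iterBlock (K - n) y →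
      laplace 1 u x = laplace 1 u x') →
      ((F.L : ℝ) ^ (K - n)) ^ 2 * ∑ ν : Fin (F.P K).d, ∑ x : Site (F.P K) 0, pdiff 1 ν u x ^ 2 ≤ (6 * 243 ^ 3 / 256) * ∑ x : Site (F.P K) 0, u x ^ 2 := by
    intro u hu
    let c : Site (F.P K) (K - n) → ℝ := fun y => if hne : (iterBlock (K - n) y).Nonempty then laplace 1 u hne.choose else 0
    refine grad_sq_le_of_blockConst_T3_all F K n u c fun y x hx => ?_
    have hne : (iterBlock (K - n) y).Nonempty := ⟨x, hx⟩
    show laplace 1 u x = (if hne : (iterBlock (K - n) y).Nonempty then laplace 1 u hne.choose else 0)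
    rw [dif_pos hne]
    exact hu y x _ hx hne.choose_spec
  have hre : ∀ i j : Fin 2, ((F.L : ℝ) ^ (K - n)) ^ 2 * ∑ ν : Fin (F.P K).d, ∑ x : Site (F.P K) 0, pdiff 1 ν (fun z => (Fn z i j).re) x ^ 2
      ≤ (6 * 243 ^ 3 / 256) * ∑ x : Site (F.P K) 0, (Fn x i j).re ^ 2 := fun i j =>
    hcomp _ fun y x x' hx hx' => by rw [← Prop7FlatProjectorSeam.laplace_entry_re, ← Prop7FlatProjectorSeam.laplace_entry_re, hblk y x x' hx hx']
  have him : ∀ i j : Fin 2, ((F.L : ℝ) ^ (K - n)) ^ 2 * ∑ ν : Fin (F.P K).d, ∑ x : Site (F.P K) 0, pdiff 1 ν (fun z => (Fn z i j).im) x ^ 2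
      ≤ (6 * 243 ^ 3 / 256) * ∑ x : Site (F.P K) 0, (Fn x i j).im ^ 2 := fun i j =>
    hcomp _ fun y x x' hx hx' => by rw [← Prop7FlatProjectorSeam.laplace_entry_im, ← Prop7FlatProjectorSeam.laplace_entry_im, hblk y x x' hx hx']
  -- the two norms on functions
  have hD : ‖DL2 F n K c₀ (1 : GaugeField (F.P K) 0 (Matrix.specialUnitaryGroup (Fin 2) ℂ)) (toL2S F K c₀ Fn)‖ ^ 2
      = c₀ * ((F.L : ℝ) ^ (K - n)) ^ 2 * ∑ b : PBond (F.P K) 0, ∑ i : Fin 2, ∑ j : Fin 2, ‖(Fn b.tgt - Fn b.src) i j‖ ^ 2 := by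
    rw [DL2_one_toL2S, norm_sq_toL2, mul_assoc]
    congr 1
    rw [Finset.mul_sum]
    refine Finset.sum_congr rfl fun b _ => ?_
    rw [Finset.mul_sum]
    refine Finset.sum_congr rfl fun i _ => ?_
    rw [Finset.mul_sum]
    refine Finset.sum_congr rfl fun j _ => ?_
    rw [Matrix.smul_apply, smul_eq_mul, norm_mul, mul_pow, norm_inv, Complex.norm_real, Real.norm_of_nonneg (eta_pos F n K).le, inv_pow,
      ← Prop7FlatProjectorSeam.inv_eta_eq (F := F) (n := n) (K := K), inv_pow]
  have hM : ‖toL2S F K c₀ Fn‖ ^ 2 = c₀ * ∑ x : Site (F.P K) 0, ∑ i : Fin 2, ∑ j : Fin 2, ‖Fn x i j‖ ^ 2 := norm_sq_toL2S Fn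
  rw [hD, hM, sum_norm_sq_diff_eq, sum_norm_sq_site_eq]
  have hc₀ : 0 ≤ c₀ := (Fact.out : 0 < c₀).le
  have hsum : ((F.L : ℝ) ^ (K - n)) ^ 2 * ∑ i : Fin 2, ∑ j : Fin 2, (∑ ν : Fin (F.P K).d, ∑ x : Site (F.P K) 0, pdiff 1 ν (fun z => (Fn z i j).re) x ^ 2
          + ∑ ν : Fin (F.P K).d, ∑ x : Site (F.P K) 0, pdiff 1 ν (fun z => (Fn z i j).im) x ^ 2)
      ≤ (6 * 243 ^ 3 / 256) * ∑ i : Fin 2, ∑ j : Fin 2, (∑ x : Site (F.P K) 0, (Fn x i j).re ^ 2 + ∑ x : Site (F.P K) 0, (Fn x i j).im ^ 2) := by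
    rw [Finset.mul_sum, Finset.mul_sum]
    refine Finset.sum_le_sum fun i _ => ?_
    rw [Finset.mul_sum, Finset.mul_sum]
    refine Finset.sum_le_sum fun j _ => ?_
    rw [mul_add, mul_add]
    exact add_le_add (hre i j) (him i j)
  have := mul_le_mul_of_nonneg_left hsum hc₀
  calc _ = c₀ * (((F.L : ℝ) ^ (K - n)) ^ 2 * ∑ i : Fin 2, ∑ j : Fin 2, (∑ ν : Fin (F.P K).d, ∑ x : Site (F.P K) 0, pdiff 1 ν (fun z => (Fn z i j).re) x ^ 2
          + ∑ ν : Fin (F.P K).d, ∑ x : Site (F.P K) 0, pdiff 1 ν (fun z => (Fn z i j).im) x ^ 2)) := by ring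
    _ ≤ c₀ * ((6 * 243 ^ 3 / 256) * ∑ i : Fin 2, ∑ j : Fin 2, (∑ x : Site (F.P K) 0, (Fn x i j).re ^ 2 + ∑ x : Site (F.P K) 0, (Fn x i j).im ^ 2)) := this
    _ = _ := by ring

omit [Fact (0 < cB)] in
/-- ★★★ **THE CRUDE SLICE ON PRINT'S SLICE AT THE FLAT MEMBER** (through the door ✓ `div_sq_le_of_bernstein_ker_RS_of_isLandauPrintS`): every route field in the projected Landau gauge
(21)ˢ at `U₀ = 1` has `‖D*_1 X̃‖² ≤ (6·243³∕256)·‖X̃‖²` — `DIV ≤ δ₁ℓ⁻²M` with `ζ = 0`, `δ₁` ABSOLUTE. [cite: Balaban1985Variational, (21) p.281, Prop. 7 p.299; Balaban1985BackgroundPropagators, (3.21) p.394] -/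
theorem div_sq_le_flat_of_isLandauPrintS_one [Fact (0 < cB)] (X : PBond (F.P K) 0 → Matrix (Fin 2) (Fin 2) ℂ)
    (hX : IsLandauPrintS F n K h c₀ cB (1 : GaugeField (F.P K) 0 (Matrix.specialUnitaryGroup (Fin 2) ℂ)) X) :
    ‖DstarL2 F n K c₀ (1 : GaugeField (F.P K) 0 (Matrix.specialUnitaryGroup (Fin 2) ℂ)) (toL2 F K c₀ X)‖ ^ 2 ≤ (6 * 243 ^ 3 / 256) * ‖toL2 F K c₀ X‖ ^ 2 :=
  div_sq_le_of_bernstein_ker_RS_of_isLandauPrintS F n K h c₀ cB 1 (by norm_num) (fun f hf => bernP_flat_member (h := h) (cB := cB) f hf) X hX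

end Summit.QuantumFields.YangMills.Theorems.Prop7BernPFlatMember

end
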